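import Literature.AlgebraicGeometry.ComplexMultiplication.CyclotomicFermatCMTypesPrimePowerLevelSimple
import HarnessLib

/-!
# Koblitz–Rohrlich, THEOREM 4 at `N = 16` IN FULL: every coincidence `H_τ = H_{τ′}` between triples with an odd entry is obvious (`τ′ ∼ τ`)
# or one of the four non-obvious classes `{(1,1,14),(1,7,8)}`, `{(1,2,13),(1,3,12)}`, `{(1,6,9),(2,2,12)}`, `{(1,6,9),(2,6,8)}`

Layer `Literature/AlgebraicGeometry/ComplexMultiplication`, namespace `…ComplexMultiplication.CyclotomicFermatCMType`; companion of
`CyclotomicFermatCMTypesTwoPowerLevelIsogenies` (Theorem 4's families at `n = 3, 4, 5`; the complete list at `N = 8`; the list at `N = 16` for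
triples through `1`) — not imported; only `CyclotomicFermatCMTypesPrimePowerLevelSimple`'s scaling lemma is used.  THEOREMS ONLY (no
definition, no named fact, no `sorry`): the normalised kernel enumeration and the normalisation glue for conclusions of the shape "`τ′ ∼ τ`,
or `X({uτ}, {u′τ′})` for units `u, u′`" with `X` a symmetric relation on multisets.

THE SOURCE.  N. Koblitz, D. Rohrlich, *Simple factors in the Jacobian of a Fermat curve*, Canad. J. Math. **30** (1978) 1183–1205, p. 1186:
"THEOREM 4. Suppose `N = 2ⁿ`. Then the only isogenies apart from the obvious ones are between pairs of lattices corresponding to the triples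
a) …, b) …, c) …, d) …, e) …" (proved in §5, pp. 1201–1205); §1 (p. 1185): `τ ∼ τ′` iff `{τ′} = {hτ}` for a unit `h`, "obvious" isogenies.

WHAT IS PROVED.

* §1 (any level `N`, any SYMMETRIC relation `X` on multisets): if for every pair with first triple `(1, s, −1−s)` a coincidence `H_{τ′} = H_τ`
  gives "`{τ′} = {uτ}` for a unit `u`, or `X({uτ}, {u′τ′})` for units `u, u′`", then the same holds for all pairs of triples of non-zero
  residues (sums `0`) with a unit among the six entries (`equiv_or_rel_of_normalised`).
* §2 `N = 16`: the normalised enumeration (`equiv_or_rel_sixteen_normalised`) and **THEOREM 4's content IN FULL at `N = 16`**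
  (`equiv_or_rel_of_fermatCMType_eq_sixteen`): for triples `τ, τ′` of non-zero residues modulo `16` with sums `0`, a unit (odd entry) among
  the six, and `H_{τ′} = H_τ`: `τ′ ∼ τ`, or for units `u, u′` the pair `({uτ}, {u′τ′})` is one of `({1,1,14},{1,7,8})`, `({1,2,13},{1,3,12})`,
  `({1,6,9},{2,2,12})`, `({1,6,9},{2,6,8})` or their transposes — the complete list of non-obvious coincidences at `16` (all four occur:
  sibling `fermatCMType_sixteen_e`, `_d₀`, `_a₀_e₁`).

## Honest column / NOT here

* As in the sibling: family b) of the printed theorem is illegible in our copy; the list here is the kernel-verified ground truth at `N = 16`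
  and matches the legible families' members; general `n` NOT typed; "isogeny" = equality of residue sets.  Kernel `decide` only
  (`maxRecDepth 100000`, enlarged instance-synthesis limits).  Private: `map_mul_triple₃`, `isUnit_iff_val_coprime₁₄`, two partial glue lemmas.

## References

* [KoblitzRohrlich1978] N. Koblitz, D. Rohrlich, Canad. J. Math. 30 (1978) 1183–1205: Theorem 4 (p. 1186), §5, §1 (pp. 1184–1185).

## Provenance

Cell `pub-hodgecm2` (COR-CM), literature seat `lit-deligne-3` gen 35 (claim KR78-THM4-16; count-neutral, own lane).
-/

open NumberField

namespace Literature.AlgebraicGeometry.ComplexMultiplication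

open Literature.AlgebraicGeometry.HodgeTheory

namespace CyclotomicFermatCMType

/-! ## §1 Any level: the normalisation glue for "equivalent, or `X`-related up to units" with `X` symmetric -/

section Glue

variable {N : ℕ} [NeZero N]

/-- The image of a triple under multiplication by `c` (private copy). [folklore] -/
private theorem map_mul_triple₃ {α : Type*} [Mul α] (c x y z : α) :
    (({x, y, z} : Multiset α).map (fun w => c * w)) = {c * x, c * y, c * z} := by
  simp only [Multiset.insert_eq_cons, Multiset.map_cons, Multiset.map_singleton]

/-- Units of `ℤ/N` are the residues with value prime to `N` (private copy of the siblings'). [folklore] -/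
private theorem isUnit_iff_val_coprime₁₄ (x : ZMod N) : IsUnit x ↔ x.val.Coprime N := by
  conv_lhs => rw [← ZMod.natCast_zmod_val x]
  exact ZMod.isUnit_iff_coprime x.val N

/-- Glue, first entry of `τ` a unit. [cite: KoblitzRohrlich1978, §1 (pp. 1184–1185)] -/
private theorem equiv_or_rel_of_isUnit_fst {X : Multiset (ZMod N) → Multiset (ZMod N) → Prop}
    (S : ∀ s r' s' : ZMod N, s ≠ 0 → (-1 - s : ZMod N) ≠ 0 → r' ≠ 0 → s' ≠ 0 → (-r' - s' : ZMod N) ≠ 0 →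
      fermatCMType N r' s' (-r' - s') = fermatCMType N 1 s (-1 - s) →
      (∃ u : ZMod N, u.val.Coprime N ∧ ({u * 1, u * s, u * (-1 - s)} : Multiset (ZMod N)) = {r', s', -r' - s'}) ∨
        ∃ u u' : ZMod N, u.val.Coprime N ∧ u'.val.Coprime N ∧
          X ({u * 1, u * s, u * (-1 - s)} : Multiset (ZMod N)) ({u' * r', u' * s', u' * (-r' - s')} : Multiset (ZMod N)))
    {r s t r' s' t' : ZMod N} (hr : IsUnit r) (hs : s ≠ 0) (ht : t ≠ 0) (hrst : r + s + t = 0)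
    (hr' : r' ≠ 0) (hs' : s' ≠ 0) (ht' : t' ≠ 0) (hrst' : r' + s' + t' = 0)
    (heq : fermatCMType N r' s' t' = fermatCMType N r s t) :
    (∃ u : ZMod N, IsUnit u ∧ ({u * r, u * s, u * t} : Multiset (ZMod N)) = {r', s', t'}) ∨
      ∃ u u' : ZMod N, IsUnit u ∧ IsUnit u' ∧
        X ({u * r, u * s, u * t} : Multiset (ZMod N)) ({u' * r', u' * s', u' * t'} : Multiset (ZMod N)) := by
  obtain rfl : t = -r - s := by linear_combination hrst
  obtain rfl : t' = -r' - s' := by linear_combination hrst'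
  obtain ⟨ri, hri⟩ := hr.exists_right_inv
  have hri' : IsUnit ri := IsUnit.of_mul_eq_one_right r hri
  have hri1 : ri * r = 1 := by rw [mul_comm]; exact hri
  have hnz : ∀ {x : ZMod N}, x ≠ 0 → ri * x ≠ 0 := by
    intro x hx h
    apply hx
    have := congrArg (fun y => r * y) h
    simpa only [← mul_assoc, hri, one_mul, mul_zero] using this
  have e₁ : ri * (-r - s) = -1 - ri * s := by linear_combination (-1 : ZMod N) * hri
  have e₂ : ri * (-r' - s') = -(ri * r') - ri * s' := by ring
  have key : fermatCMType N (ri * r') (ri * s') (ri * (-r' - s')) = fermatCMType N (ri * r) (ri * s) (ri * (-r - s)) := by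
    ext x
    rw [mem_fermatCMType_mul_iff_of_isUnit hri', mem_fermatCMType_mul_iff_of_isUnit hri', heq]
  rw [hri1, e₁, e₂] at key
  have c₂ : (-1 - ri * s : ZMod N) ≠ 0 := by rw [← e₁]; exact hnz ht
  have c₅ : (-(ri * r') - ri * s' : ZMod N) ≠ 0 := by rw [← e₂]; exact hnz ht'
  have f₁ : ∀ u : ZMod N, u * ri * r = u * 1 := fun u => by rw [mul_assoc, hri1]
  have f₂ : ∀ u : ZMod N, u * ri * s = u * (ri * s) := fun u => mul_assoc _ _ _
  have f₃ : ∀ u : ZMod N, u * ri * (-r - s) = u * (-1 - ri * s) := fun u => by rw [mul_assoc, e₁]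
  have f₄ : ∀ u : ZMod N, u * ri * r' = u * (ri * r') := fun u => mul_assoc _ _ _
  have f₅ : ∀ u : ZMod N, u * ri * s' = u * (ri * s') := fun u => mul_assoc _ _ _
  have f₆ : ∀ u : ZMod N, u * ri * (-r' - s') = u * (-(ri * r') - ri * s') := fun u => by rw [mul_assoc, e₂]
  rcases S (ri * s) (ri * r') (ri * s') (hnz hs) c₂ (hnz hr') (hnz hs') c₅ key with ⟨u, hu, h⟩ | ⟨u, u', hu, hu', hX⟩
  · -- `{u τ₁} = {τ₁′}`: multiply by `r`
    left
    refine ⟨u, (isUnit_iff_val_coprime₁₄ u).2 hu, ?_⟩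
    have h' := congrArg (Multiset.map (fun w => r * w)) h
    rwa [map_mul_triple₃, map_mul_triple₃, show r * (ri * r') = r' by linear_combination r' * hri,
      show r * (ri * s') = s' by linear_combination s' * hri,
      show r * (-(ri * r') - ri * s') = -r' - s' by linear_combination (-r' - s') * hri,
      show r * (u * 1) = u * r by ring, show r * (u * (ri * s)) = u * s by linear_combination (u * s) * hri,
      show r * (u * (-1 - ri * s)) = u * (-r - s) by linear_combination (-(u * s)) * hri] at h'
  · right
    refine ⟨u * ri, u' * ri, ((isUnit_iff_val_coprime₁₄ u).2 hu).mul hri', ((isUnit_iff_val_coprime₁₄ u').2 hu').mul hri', ?_⟩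
    rw [f₁, f₂, f₃, f₄, f₅, f₆]
    exact hX

/-- Glue, some entry of `τ` a unit: permute it to the front. [cite: KoblitzRohrlich1978, §1 (pp. 1184–1185)] -/
private theorem equiv_or_rel_of_isUnit {X : Multiset (ZMod N) → Multiset (ZMod N) → Prop}
    (S : ∀ s r' s' : ZMod N, s ≠ 0 → (-1 - s : ZMod N) ≠ 0 → r' ≠ 0 → s' ≠ 0 → (-r' - s' : ZMod N) ≠ 0 →
      fermatCMType N r' s' (-r' - s') = fermatCMType N 1 s (-1 - s) →
      (∃ u : ZMod N, u.val.Coprime N ∧ ({u * 1, u * s, u * (-1 - s)} : Multiset (ZMod N)) = {r', s', -r' - s'}) ∨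
        ∃ u u' : ZMod N, u.val.Coprime N ∧ u'.val.Coprime N ∧
          X ({u * 1, u * s, u * (-1 - s)} : Multiset (ZMod N)) ({u' * r', u' * s', u' * (-r' - s')} : Multiset (ZMod N)))
    {r s t r' s' t' : ZMod N} (hr : r ≠ 0) (hs : s ≠ 0) (ht : t ≠ 0) (hrst : r + s + t = 0)
    (hr' : r' ≠ 0) (hs' : s' ≠ 0) (ht' : t' ≠ 0) (hrst' : r' + s' + t' = 0) (hunit : IsUnit r ∨ IsUnit s ∨ IsUnit t)
    (heq : fermatCMType N r' s' t' = fermatCMType N r s t) :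
    (∃ u : ZMod N, IsUnit u ∧ ({u * r, u * s, u * t} : Multiset (ZMod N)) = {r', s', t'}) ∨
      ∃ u u' : ZMod N, IsUnit u ∧ IsUnit u' ∧
        X ({u * r, u * s, u * t} : Multiset (ZMod N)) ({u' * r', u' * s', u' * t'} : Multiset (ZMod N)) := by
  have p12 : ∀ a b c : ZMod N, ({a, b, c} : Multiset (ZMod N)) = {b, a, c} := fun a b c => by
    rw [Multiset.insert_eq_cons, Multiset.insert_eq_cons, Multiset.insert_eq_cons, Multiset.insert_eq_cons, Multiset.cons_swap]
  have p23 : ∀ a b c : ZMod N, ({a, b, c} : Multiset (ZMod N)) = {a, c, b} := fun a b c => by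
    rw [Multiset.pair_comm b c]
  have p13 : ∀ a b c : ZMod N, ({a, b, c} : Multiset (ZMod N)) = {c, b, a} := fun a b c => by
    rw [p23 a b c, p12 a c b, p23 c a b]
  rcases hunit with hu | hu | hu
  · exact equiv_or_rel_of_isUnit_fst S hu hs ht hrst hr' hs' ht' hrst' heq
  · have heq' : fermatCMType N r' s' t' = fermatCMType N s r t := by rw [heq]; exact fermatCMType_eq_of_multiset_eq (p12 r s t)
    rcases equiv_or_rel_of_isUnit_fst S hu hr ht (by linear_combination hrst) hr' hs' ht' hrst' heq' with
      ⟨u, hu', h⟩ | ⟨u, u', hu', hu'', hX⟩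
    · exact Or.inl ⟨u, hu', (p12 _ _ _).trans h⟩
    · exact Or.inr ⟨u, u', hu', hu'', by rw [p12 (u * r)]; exact hX⟩
  · have heq' : fermatCMType N r' s' t' = fermatCMType N t s r := by rw [heq]; exact fermatCMType_eq_of_multiset_eq (p13 r s t)
    rcases equiv_or_rel_of_isUnit_fst S hu hs hr (by linear_combination hrst) hr' hs' ht' hrst' heq' with
      ⟨u, hu', h⟩ | ⟨u, u', hu', hu'', hX⟩
    · exact Or.inl ⟨u, hu', (p13 _ _ _).trans h⟩
    · exact Or.inr ⟨u, u', hu', hu'', by rw [p13 (u * r)]; exact hX⟩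

/-- **The normalisation glue for "equivalent, or `X`-related up to units"** (any level, `X` SYMMETRIC): the normalised statement (first
triple through `1`) implies the statement for all pairs of triples of non-zero residues (sums `0`) with a unit among the six entries (scale,
permute; when the unit entry is in `τ′`, swap and use the symmetry of `X` and `{uτ′} = {τ} ⟹ {u⁻¹τ} = {τ′}`).
[cite: KoblitzRohrlich1978, §1 (pp. 1184–1185) and Theorem 4 (p. 1186)] -/
theorem equiv_or_rel_of_normalised {X : Multiset (ZMod N) → Multiset (ZMod N) → Prop} (hX : ∀ S T, X S T → X T S)
    (S : ∀ s r' s' : ZMod N, s ≠ 0 → (-1 - s : ZMod N) ≠ 0 → r' ≠ 0 → s' ≠ 0 → (-r' - s' : ZMod N) ≠ 0 →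
      fermatCMType N r' s' (-r' - s') = fermatCMType N 1 s (-1 - s) →
      (∃ u : ZMod N, u.val.Coprime N ∧ ({u * 1, u * s, u * (-1 - s)} : Multiset (ZMod N)) = {r', s', -r' - s'}) ∨
        ∃ u u' : ZMod N, u.val.Coprime N ∧ u'.val.Coprime N ∧
          X ({u * 1, u * s, u * (-1 - s)} : Multiset (ZMod N)) ({u' * r', u' * s', u' * (-r' - s')} : Multiset (ZMod N)))
    {r s t r' s' t' : ZMod N} (hr : r ≠ 0) (hs : s ≠ 0) (ht : t ≠ 0) (hrst : r + s + t = 0)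
    (hr' : r' ≠ 0) (hs' : s' ≠ 0) (ht' : t' ≠ 0) (hrst' : r' + s' + t' = 0)
    (hunit : IsUnit r ∨ IsUnit s ∨ IsUnit t ∨ IsUnit r' ∨ IsUnit s' ∨ IsUnit t')
    (heq : fermatCMType N r' s' t' = fermatCMType N r s t) :
    (∃ u : ZMod N, IsUnit u ∧ ({u * r, u * s, u * t} : Multiset (ZMod N)) = {r', s', t'}) ∨
      ∃ u u' : ZMod N, IsUnit u ∧ IsUnit u' ∧
        X ({u * r, u * s, u * t} : Multiset (ZMod N)) ({u' * r', u' * s', u' * t'} : Multiset (ZMod N)) := by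
  -- the swap: from the statement for `(τ′, τ)` to the one for `(τ, τ′)`
  have swap : ((∃ u : ZMod N, IsUnit u ∧ ({u * r', u * s', u * t'} : Multiset (ZMod N)) = {r, s, t}) ∨
      ∃ u u' : ZMod N, IsUnit u ∧ IsUnit u' ∧
        X ({u * r', u * s', u * t'} : Multiset (ZMod N)) ({u' * r, u' * s, u' * t} : Multiset (ZMod N))) →
      (∃ u : ZMod N, IsUnit u ∧ ({u * r, u * s, u * t} : Multiset (ZMod N)) = {r', s', t'}) ∨
        ∃ u u' : ZMod N, IsUnit u ∧ IsUnit u' ∧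
          X ({u * r, u * s, u * t} : Multiset (ZMod N)) ({u' * r', u' * s', u' * t'} : Multiset (ZMod N)) := by
    rintro (⟨u, hu, h⟩ | ⟨u, u', hu, hu', hX'⟩)
    · left
      obtain ⟨ui, hui⟩ := hu.exists_right_inv
      refine ⟨ui, IsUnit.of_mul_eq_one_right u hui, ?_⟩
      have h' := congrArg (Multiset.map (fun w => ui * w)) h
      rw [map_mul_triple₃, map_mul_triple₃, show ui * (u * r') = r' by linear_combination r' * hui,
        show ui * (u * s') = s' by linear_combination s' * hui, show ui * (u * t') = t' by linear_combination t' * hui] at h'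
      exact h'.symm
    · exact Or.inr ⟨u', u, hu', hu, hX _ _ hX'⟩
  rcases hunit with hu | hu | hu | hu | hu | hu
  · exact equiv_or_rel_of_isUnit S hr hs ht hrst hr' hs' ht' hrst' (Or.inl hu) heq
  · exact equiv_or_rel_of_isUnit S hr hs ht hrst hr' hs' ht' hrst' (Or.inr (Or.inl hu)) heq
  · exact equiv_or_rel_of_isUnit S hr hs ht hrst hr' hs' ht' hrst' (Or.inr (Or.inr hu)) heq
  · exact swap (equiv_or_rel_of_isUnit S hr' hs' ht' hrst' hr hs ht hrst (Or.inl hu) heq.symm)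
  · exact swap (equiv_or_rel_of_isUnit S hr' hs' ht' hrst' hr hs ht hrst (Or.inr (Or.inl hu)) heq.symm)
  · exact swap (equiv_or_rel_of_isUnit S hr' hs' ht' hrst' hr hs ht hrst (Or.inr (Or.inr hu)) heq.symm)

end Glue

/-! ## §2 `N = 16`: Theorem 4's content in full -/

section Sixteen

set_option maxRecDepth 100000 in
set_option maxHeartbeats 4000000 in
set_option synthInstance.maxHeartbeats 400000 in
set_option synthInstance.maxSize 100000 in
/-- **Enumeration at `N = 16`, normalised form** (kernel computation): for `s, −1−s, r′, s′, −r′−s′` non-zero modulo `16` with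
`H_{(r′,s′,−r′−s′)} = H_{(1,s,−1−s)}`: `{u·(1,s,−1−s)} = {r′,s′,−r′−s′}` for a unit `u`, or for units `u, u′` the pair
`({u·(1,s,−1−s)}, {u′·(r′,s′,−r′−s′)})` is one of the eight listed (four classes, both orders). [cite: KoblitzRohrlich1978, Theorem 4 (p. 1186)] -/
theorem equiv_or_rel_sixteen_normalised :
    ∀ s r' s' : ZMod 16, s ≠ 0 → (-1 - s : ZMod 16) ≠ 0 → r' ≠ 0 → s' ≠ 0 → (-r' - s' : ZMod 16) ≠ 0 →
      fermatCMType 16 r' s' (-r' - s') = fermatCMType 16 1 s (-1 - s) →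
      (∃ u : ZMod 16, u.val.Coprime 16 ∧ ({u * 1, u * s, u * (-1 - s)} : Multiset (ZMod 16)) = {r', s', -r' - s'}) ∨
        ∃ u u' : ZMod 16, u.val.Coprime 16 ∧ u'.val.Coprime 16 ∧
          (fun S T : Multiset (ZMod 16) =>
            (S = {1, 1, 14} ∧ T = {1, 7, 8}) ∨ (S = {1, 7, 8} ∧ T = {1, 1, 14}) ∨
            (S = {1, 2, 13} ∧ T = {1, 3, 12}) ∨ (S = {1, 3, 12} ∧ T = {1, 2, 13}) ∨
            (S = {1, 6, 9} ∧ T = {2, 2, 12}) ∨ (S = {2, 2, 12} ∧ T = {1, 6, 9}) ∨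
            (S = {1, 6, 9} ∧ T = {2, 6, 8}) ∨ (S = {2, 6, 8} ∧ T = {1, 6, 9}))
            ({u * 1, u * s, u * (-1 - s)} : Multiset (ZMod 16)) ({u' * r', u' * s', u' * (-r' - s')} : Multiset (ZMod 16)) := by
  decide

/-- The listed relation is symmetric. [folklore] -/
private theorem rel_sixteen_symm : ∀ S T : Multiset (ZMod 16),
    (fun S T : Multiset (ZMod 16) =>
        (S = {1, 1, 14} ∧ T = {1, 7, 8}) ∨ (S = {1, 7, 8} ∧ T = {1, 1, 14}) ∨
        (S = {1, 2, 13} ∧ T = {1, 3, 12}) ∨ (S = {1, 3, 12} ∧ T = {1, 2, 13}) ∨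
        (S = {1, 6, 9} ∧ T = {2, 2, 12}) ∨ (S = {2, 2, 12} ∧ T = {1, 6, 9}) ∨
        (S = {1, 6, 9} ∧ T = {2, 6, 8}) ∨ (S = {2, 6, 8} ∧ T = {1, 6, 9})) S T →
    (fun S T : Multiset (ZMod 16) =>
        (S = {1, 1, 14} ∧ T = {1, 7, 8}) ∨ (S = {1, 7, 8} ∧ T = {1, 1, 14}) ∨
        (S = {1, 2, 13} ∧ T = {1, 3, 12}) ∨ (S = {1, 3, 12} ∧ T = {1, 2, 13}) ∨
        (S = {1, 6, 9} ∧ T = {2, 2, 12}) ∨ (S = {2, 2, 12} ∧ T = {1, 6, 9}) ∨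
        (S = {1, 6, 9} ∧ T = {2, 6, 8}) ∨ (S = {2, 6, 8} ∧ T = {1, 6, 9})) T S := by
  rintro S T (⟨rfl, rfl⟩ | ⟨rfl, rfl⟩ | ⟨rfl, rfl⟩ | ⟨rfl, rfl⟩ | ⟨rfl, rfl⟩ | ⟨rfl, rfl⟩ | ⟨rfl, rfl⟩ | ⟨rfl, rfl⟩) <;> decide

/-- **THEOREM 4's content IN FULL at `N = 16`**: for triples `τ = (r,s,t)`, `τ′ = (r′,s′,t′)` of non-zero residues modulo `16` with
`r + s + t = r′ + s′ + t′ = 0`, a unit (odd entry) among the six, and `H_{τ′} = H_τ`: either `τ′ ∼ τ` (`{τ′} = {uτ}` for a unit `u` — obvious),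
or for units `u, u′` the pair `({uτ}, {u′τ′})` is one of `({1,1,14},{1,7,8})`, `({1,2,13},{1,3,12})`, `({1,6,9},{2,2,12})`, `({1,6,9},{2,6,8})`
or a transpose — "the only isogenies apart from the obvious ones" at `N = 16`. [cite: KoblitzRohrlich1978, Theorem 4 (p. 1186)] -/
theorem equiv_or_rel_of_fermatCMType_eq_sixteen {r s t r' s' t' : ZMod 16} (hr : r ≠ 0) (hs : s ≠ 0) (ht : t ≠ 0)
    (hrst : r + s + t = 0) (hr' : r' ≠ 0) (hs' : s' ≠ 0) (ht' : t' ≠ 0) (hrst' : r' + s' + t' = 0)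
    (hunit : IsUnit r ∨ IsUnit s ∨ IsUnit t ∨ IsUnit r' ∨ IsUnit s' ∨ IsUnit t')
    (heq : fermatCMType 16 r' s' t' = fermatCMType 16 r s t) :
    (∃ u : ZMod 16, IsUnit u ∧ ({u * r, u * s, u * t} : Multiset (ZMod 16)) = {r', s', t'}) ∨
      ∃ u u' : ZMod 16, IsUnit u ∧ IsUnit u' ∧
        ((({u * r, u * s, u * t} : Multiset (ZMod 16)) = {1, 1, 14} ∧ ({u' * r', u' * s', u' * t'} : Multiset (ZMod 16)) = {1, 7, 8}) ∨
          (({u * r, u * s, u * t} : Multiset (ZMod 16)) = {1, 7, 8} ∧ ({u' * r', u' * s', u' * t'} : Multiset (ZMod 16)) = {1, 1, 14}) ∨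
          (({u * r, u * s, u * t} : Multiset (ZMod 16)) = {1, 2, 13} ∧ ({u' * r', u' * s', u' * t'} : Multiset (ZMod 16)) = {1, 3, 12}) ∨
          (({u * r, u * s, u * t} : Multiset (ZMod 16)) = {1, 3, 12} ∧ ({u' * r', u' * s', u' * t'} : Multiset (ZMod 16)) = {1, 2, 13}) ∨
          (({u * r, u * s, u * t} : Multiset (ZMod 16)) = {1, 6, 9} ∧ ({u' * r', u' * s', u' * t'} : Multiset (ZMod 16)) = {2, 2, 12}) ∨
          (({u * r, u * s, u * t} : Multiset (ZMod 16)) = {2, 2, 12} ∧ ({u' * r', u' * s', u' * t'} : Multiset (ZMod 16)) = {1, 6, 9}) ∨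
          (({u * r, u * s, u * t} : Multiset (ZMod 16)) = {1, 6, 9} ∧ ({u' * r', u' * s', u' * t'} : Multiset (ZMod 16)) = {2, 6, 8}) ∨
          (({u * r, u * s, u * t} : Multiset (ZMod 16)) = {2, 6, 8} ∧ ({u' * r', u' * s', u' * t'} : Multiset (ZMod 16)) = {1, 6, 9})) :=
  equiv_or_rel_of_normalised rel_sixteen_symm equiv_or_rel_sixteen_normalised hr hs ht hrst hr' hs' ht' hrst' hunit heq

end Sixteen

end CyclotomicFermatCMType

end Literature.AlgebraicGeometry.ComplexMultiplication
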